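import Mathlib
import Literature.LinearAlgebra.TensorNetworks.TensorTrainSVD
import Literature.LinearAlgebra.TensorNetworks.TensorTrainGauge
import Literature.LinearAlgebra.TensorNetworks.TensorTrainOrthogonal
import Literature.LinearAlgebra.Matrix.FrobeniusNormSingularValues

/-!
# TT-rounding: the TT-SVD executed on the cores of a tensor train

Oseledets, *Tensor-train decomposition*, SIAM J. Sci. Comput. 33 (2011), §3, Algorithm 2
("TT-rounding") — the paper is not held (acquisition request acq-09604); the algorithm is read
through its restatement as Algorithm "TT-Rounding" of Al Daas–Ballard–Cazeaux–Hallman–Międlar–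
Pasha–Reid–Saibaba, *Randomized algorithms for rounding in the tensor-train format*
(`DaasEtAl2021`), §2.3 "Standard TT arithmetic" (arXiv:2110.04393: right-orthogonalise, then sweep
left to right truncating the SVD of each vertical unfolding and passing `Σ Vᵀ` to the next core;
"the resulting tensor satisfies `‖X - Y‖ ≤ ε₀ ‖X‖`"), and through Schollwöck, Ann. Phys. 326 (2011),
§4.5.1 "Compressing a matrix product state by SVD" (the mirror-image sweep on a left-canonical
state; "one-sided interdependence of truncations"); Uschmajew–Vandereycken, *Geometric methods
on low-rank matrix and tensor manifolds* (2020), §3.2 (TT-SVD); Lee–Cichocki, arXiv:1405.7786,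
§3.4–§3.5, §4 ("such operations usually increase the TT-ranks, which requires truncation").  As
in `TensorTrainSVD`, no theorem number of [Oseledets2011] is asserted; the error bound is cited in
the verified form [OseledetsTyrtyshnikov2010, Thm 2.2] (TT-SVD) and transported to rounding here.

This is item #30 of the TT lane; it formalises the line "Not formalised: TT-rounding as an
algorithm on the cores" left open in `TensorTrainOrthogonal`.

## The algorithm (truncation phase of Algorithm 2)

Input: a train `T : TensorTrain ℝ σ L` which is RIGHT-ORTHONORMAL at the sites `0 < j < L`
(`∑ a, G_j(a) G_j(a)ᵀ = 1`, `r_L = 1`, right boundary vector `1`; the left boundary vector and `r_0`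
are arbitrary) — this is the output of the orthogonalisation phase of Algorithm 2 — and a local rule
`lsel : LocalRule σ` choosing, from a matrix `M̃` with `r · |σ|` rows and `r_{k+1}` columns, a new
bond dimension `q` and a matrix `U` with `q` columns. The sweep `roundSweep` runs over the sites
`k = 0, …, L - 2` carrying an `r × r_k` matrix `X` (initially the row vector `T.lbdry`):
* form the LOCAL matrix `M̃ = localStep X (T.core k)`, `M̃[(α,a), γ] = (X · G_k(a))[α, γ]`
  (size `(r·|σ|) × r_{k+1}` — polynomial, never the `|σ|^{L-k-1}` columns of the TT-SVD step);
* `(q, U) := lsel k r r_{k+1} M̃`; the new core at site `k` is `U` reshaped,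
  `B_k(a)[α, β] = U[(α,a), β]`;
* carry `X' := Uᵀ M̃` (for the SVD rule this is `Σ Vᵀ` restricted to the kept singular triplets);
the last site keeps `X · G_{L-1}(a) · rbdry` as its core. `ttRound lsel T` is the resulting train
and `roundLoss` / `ttRoundLoss` the sum over the sweep of the local discarded parts
`‖M̃ - U Uᵀ M̃‖²_F`. The rule `localSvdSel rk` takes for `U` an orthonormal basis of a dominant
singular subspace of `M̃` of dimension `min (rk (k+1)) r_{k+1}` (chosen by `Classical.choose` from
`exists_orthonormalCols_proj_optimal`, not by a numerical SVD).

## Results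

Structural facts, for every local rule: `ttRound_r_zero`, `ttRound_lbdry`, `ttRound_r_last`,
`ttRound_rbdry`; bond dimensions `(ttRound (localSvdSel rk) T).r k ≤ min (rk k) (T.r k)`
(`ttRound_r_le`) — rounding never increases a bond; the output is LEFT-orthonormal at the sites
`j + 1 < L` whenever the rule returns orthonormal columns (`ttRound_transpose_core_mul_core`).

LOCALITY (the heart of the matter, `roundSweep_eq_ttSweep`): if the tail interfaces
`Q_{k+1} = T.rightInterface (k+1) m` have orthonormal rows — which is what right-orthonormality of
the input gives (`TensorTrain.rightInterface_mul_transpose_self` of `TensorTrainGauge`) — then the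
matrix the TT-SVD sweep `ttSweep` of `TensorTrainSVD` would decompose at step `k` is
`M = M̃ · Q_{k+1}` (`stepMatrix_eq_localStep_mul`), and a dominant singular subspace of `M̃` is one
of `M` (`sum_sq_sub_proj_le_of_mul_transpose_mul`: `‖M - U Uᵀ M‖_F = ‖M̃ - U Uᵀ M̃‖_F` and
`rank (R Q_{k+1}ᵀ) ≤ rank R`). Hence `ttRound (localSvdSel rk) T` IS the TT-SVD `ttSweep` of the
full tensor `T.eval` for the lifted selection rule `liftSel rk T` (`ttRound_eq_ttSweep`), and every
guarantee of `TensorTrainSVD` transfers: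
* `sum_sq_sub_eval_ttRound_eq_loss`: `‖T - ttRound‖²_F = ttRoundLoss` EXACTLY — the a-posteriori
  error is the sum of the local discarded weights (Schollwöck's "one-sided interdependence of
  truncations" made quantitative: the local matrices are truncation-dependent, the identity is
  exact);
* `sum_sq_sub_eval_ttRound_le`: `‖T - ttRound‖²_F ≤ ∑_{0<k<L} ε_k²` for any bounds `ε_k²` on the
  rank-`rk k` approximation errors of the unfoldings `T_⟨k⟩` (the TT-SVD bound
  [OseledetsTyrtyshnikov2010, Thm 2.2; Oseledets2011, §2] for the rounding algorithm of §3);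
  `…_of_singularValues`: with the tail sums of squared singular values of `T_⟨k⟩`;
* `sum_sq_sub_eval_ttRound_le_mul`: quasi-optimality `‖T - ttRound‖_F ≤ √(L-1) ‖T - T'‖_F` against
  every train `T'` with bonds `T'.r k ≤ rk k` (quasi-optimality, [Oseledets2011, §2–§3]);
* `eval_ttRound_eq`: rounding is EXACT when `rank T_⟨k⟩ ≤ rk k` for all `0 < k < L` — in particular
  (`eval_ttRound_eq_of_r_le`) when `T.r k ≤ rk k`, and with `rk k := rank T_⟨k⟩` the rounded train
  has the minimal bond dimensions `rank T_⟨k⟩` and still represents `T` (recompression to the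
  TT-ranks, [Oseledets 2011, §3]);
* `exists_gauge_sum_sq_sub_eval_ttRound_le`: BOTH PHASES for a minimal representation — the
  orthogonalisation phase as the gauge transformation of `TensorTrain.exists_gauge_orthogonal`
  (`TensorTrainOrthogonal`, centre `0`: same bonds, same tensor), then `ttRound` on the gauged
  train, with the same error bound against the tensor of `T`.

## Conventions and scope

Bond-dimension changes are realised, as in `TensorTrainSVD`, by rebuilding the train with
`TensorTrain.cons` (no casts between `Fin` types); all errors are squared Frobenius norms written as
double sums of squares of entries. Not formalised here: the orthogonalisation phase AS A QR SWEEP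
(it enters only as the existence of a right-orthonormal gauge representative of a minimal train;
for non-minimal trains the QR sweep also shrinks bonds), the `ε`-threshold rank choice (our rule is
rank-capped: `rk` is an input), and floating-point issues; the SVD is an existence statement
(`Classical.choose`), not a numerical method.
-/

open Matrix Finset

namespace Literature.LinearAlgebra.TensorNetworks

/-! ## Dominant subspaces are blind to an orthonormal-row factor on the right -/

section OrthonormalRows

variable {ρ κ τ μ : Type*} [Fintype ρ] [Fintype κ] [DecidableEq κ] [Fintype τ] [Fintype μ]

/-- Multiplying by `Qᵀ` for a `Q` with orthonormal rows (`Q Qᵀ = 1`) does not increase the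
Frobenius norm: `‖X Qᵀ‖_F ≤ ‖X‖_F`.  [cite: GolubVanLoan2013, §2.3.5]
[cite: HornJohnson2013, §7.3 (P7.3.11)] -/
theorem sum_sq_mul_transpose_le (Q : Matrix κ τ ℝ) (hQ : Q * Qᵀ = 1) (X : Matrix ρ τ ℝ) :
    ∑ i, ∑ a, (X * Qᵀ) i a ^ 2 ≤ ∑ i, ∑ t, X i t ^ 2 := by
  have h := sum_sq_transpose_mul_le Qᵀ (by rwa [Matrix.transpose_transpose]) Xᵀ
  rw [← Matrix.transpose_mul] at h
  simp only [Matrix.transpose_apply] at h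
  calc ∑ i, ∑ a, (X * Qᵀ) i a ^ 2 = ∑ a, ∑ i, (X * Qᵀ) i a ^ 2 := Finset.sum_comm
    _ ≤ ∑ t, ∑ i, X i t ^ 2 := h
    _ = ∑ i, ∑ t, X i t ^ 2 := Finset.sum_comm

/-- If `M = M Qᵀ Q` for a `Q` with orthonormal rows (the rows of `M` lie in the row space of `Q`),
then for every `U` the residual of the projection `M ↦ U Uᵀ M` has the same Frobenius norm as the
residual for the small matrix `M Qᵀ`: `‖M - U Uᵀ M‖_F = ‖M Qᵀ - U Uᵀ (M Qᵀ)‖_F`.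
[cite: GolubVanLoan2013, §2.3.5] [cite: Oseledets2011, §3] -/
theorem sum_sq_sub_proj_eq_of_mul_transpose_mul (Q : Matrix κ τ ℝ) (hQ : Q * Qᵀ = 1)
    (M : Matrix ρ τ ℝ) (hM : M * Qᵀ * Q = M) (U : Matrix ρ μ ℝ) :
    ∑ i, ∑ t, (M - U * (Uᵀ * M)) i t ^ 2 =
      ∑ i, ∑ a, (M * Qᵀ - U * (Uᵀ * (M * Qᵀ))) i a ^ 2 := by
  have e : (M * Qᵀ - U * (Uᵀ * (M * Qᵀ))) * Q = M - U * (Uᵀ * M) := by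
    rw [Matrix.sub_mul, hM, Matrix.mul_assoc, Matrix.mul_assoc, hM]
  rw [← e, sum_sq_mul_of_mul_transpose_self_eq_one Q hQ]

/-- LOCALITY OF THE DOMINANT SUBSPACE.  If `M = M Qᵀ Q` with `Q Qᵀ = 1` and `U Uᵀ` is an optimal
projection of the SMALL matrix `M Qᵀ` among matrices of rank `≤ c`, then `U Uᵀ` is an optimal
projection of `M` among matrices of rank `≤ c`: `‖M - U Uᵀ M‖_F ≤ ‖M - R‖_F` whenever `rank R ≤ c`
(because `‖M - R‖_F ≥ ‖(M - R) Qᵀ‖_F = ‖M Qᵀ - R Qᵀ‖_F` and `rank (R Qᵀ) ≤ rank R`).  This is why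
TT-rounding may decompose the `(r·|σ|) × r_{k+1}` local matrix instead of the unfolding with
`|σ|^{L-k-1}` columns.  [cite: Oseledets2011, §3] [cite: GolubVanLoan2013, §2.4.2] -/
theorem sum_sq_sub_proj_le_of_mul_transpose_mul (Q : Matrix κ τ ℝ) (hQ : Q * Qᵀ = 1)
    (M : Matrix ρ τ ℝ) (hM : M * Qᵀ * Q = M) (U : Matrix ρ μ ℝ) (c : ℕ)
    (hopt : ∀ R' : Matrix ρ κ ℝ, R'.rank ≤ c →
      ∑ i, ∑ a, (M * Qᵀ - U * (Uᵀ * (M * Qᵀ))) i a ^ 2 ≤ ∑ i, ∑ a, (M * Qᵀ - R') i a ^ 2)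
    (R : Matrix ρ τ ℝ) (hR : R.rank ≤ c) :
    ∑ i, ∑ t, (M - U * (Uᵀ * M)) i t ^ 2 ≤ ∑ i, ∑ t, (M - R) i t ^ 2 := by
  rw [sum_sq_sub_proj_eq_of_mul_transpose_mul Q hQ M hM U]
  calc ∑ i, ∑ a, (M * Qᵀ - U * (Uᵀ * (M * Qᵀ))) i a ^ 2
      ≤ ∑ i, ∑ a, (M * Qᵀ - R * Qᵀ) i a ^ 2 :=
        hopt (R * Qᵀ) ((Matrix.rank_mul_le_left _ _).trans hR)
    _ = ∑ i, ∑ a, ((M - R) * Qᵀ) i a ^ 2 := by rw [Matrix.sub_mul]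
    _ ≤ ∑ i, ∑ t, (M - R) i t ^ 2 := sum_sq_mul_transpose_le Q hQ (M - R)

end OrthonormalRows

/-! ## The sweep on the cores -/

section Rounding

variable {σ : Type*}

/-- The LOCAL MATRIX of the rounding step at site `k`: for the carried `r × r_k` matrix `X` and the
core `G_k`, `localStep X G_k [(α, a), γ] = (X · G_k(a))[α, γ]` — the matrix
`[X G_k(a₁); X G_k(a₂); …]` of size `(r·|σ|) × r_{k+1}` whose SVD Algorithm 2 computes.
[cite: Oseledets2011, §3, Alg. 2] -/
def localStep {r ρ ρ' : ℕ} (X : Matrix (Fin r) (Fin ρ) ℝ) (G : σ → Matrix (Fin ρ) (Fin ρ') ℝ) :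
    Matrix (Fin r × σ) (Fin ρ') ℝ :=
  Matrix.of fun q γ => (X * G q.2) q.1 γ

/-- Entries of the local matrix.  [cite: Oseledets2011, §3, Alg. 2] -/
@[simp] theorem localStep_apply {r ρ ρ' : ℕ} (X : Matrix (Fin r) (Fin ρ) ℝ)
    (G : σ → Matrix (Fin ρ) (Fin ρ') ℝ) (α : Fin r) (a : σ) (γ : Fin ρ') :
    localStep X G (α, a) γ = (X * G a) α γ := rfl

/-- A LOCAL SELECTION RULE: at site `k`, given the carried dimension `r`, the next bond dimension
`n` and the `(r·|σ|) × n` local matrix, return the new bond dimension `q` and a matrix `U` with `q`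
columns (for rounding: orthonormal columns spanning a dominant singular subspace).
[cite: Oseledets2011, §3, Alg. 2] -/
abbrev LocalRule (σ : Type*) : Type _ :=
  ℕ → (r n : ℕ) → Matrix (Fin r × σ) (Fin n) ℝ → (q : ℕ) × Matrix (Fin r × σ) (Fin q) ℝ

/-- Reading of the carried matrix against the empty tail: `(X · Q_k^{(0)})[α, ()] = (X · rbdry)[α]`.
[cite: Oseledets2011, §3] -/
theorem mul_rightInterface_zero_apply {L k r : ℕ} (T : TensorTrain ℝ σ L) (h : k + 0 = L)
    (X : Matrix (Fin r) (Fin (T.r k)) ℝ) (α : Fin r) (t : Fin 0 → σ) :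
    (X * T.rightInterface k 0 h) α t = (X *ᵥ fun γ => T.rbdry (γ.cast (congrArg T.r h))) α := by
  simp only [Matrix.mul_apply, Matrix.mulVec, dotProduct, TensorTrain.rightInterface_zero]

/-- Reading of the carried matrix against a one-site tail:
`(X · Q_k^{(1)})[α, a] = (X · G_k(a) · rbdry)[α]`.  [cite: Oseledets2011, §3] -/
theorem mul_rightInterface_one_apply {L k r : ℕ} (T : TensorTrain ℝ σ L) (h : k + 1 = L)
    (X : Matrix (Fin r) (Fin (T.r k)) ℝ) (α : Fin r) (a : σ) :
    (X * T.rightInterface k 1 h) α (fun _ => a) =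
      ((X * T.core k a) *ᵥ fun γ => T.rbdry (γ.cast (congrArg T.r h))) α := by
  have ha : (fun _ : Fin 1 => a) = Fin.cons a Fin.elim0 := by
    funext i
    rw [Subsingleton.elim i 0, Fin.cons_zero]
  rw [ha]
  simp only [Matrix.mul_apply, Matrix.mulVec, dotProduct, TensorTrain.rightInterface_cons,
    TensorTrain.rightInterface_zero, Finset.mul_sum, Finset.sum_mul, mul_assoc]
  rw [Finset.sum_comm]

variable [Fintype σ]

/-- THE ROUNDING SWEEP (truncation phase of TT-rounding) over the sites `k, …, k + n - 1` of `T`,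
carrying the `r × r_k` matrix `X`: at each site form the local matrix `M̃ = localStep X G_k`, select
`(q, U) := lsel k r r_{k+1} M̃`, emit the core `U` reshaped (`B(a)[α, β] = U[(α,a), β]`) and carry
`Uᵀ M̃`; the last site keeps `X · G(a) · rbdry`.  The result is a train of length `n` with
`r_0 = r`, assembled with `TensorTrain.cons`.  [cite: Oseledets2011, §3, Alg. 2]
[cite: DaasEtAl2021, §2.3, Alg. "TT-Rounding"] [cite: Schollwoeck2011AnnPhys, §4.5.1] -/
noncomputable def roundSweep (lsel : LocalRule σ) {L : ℕ} (T : TensorTrain ℝ σ L) :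
    (k n r : ℕ) → k + n = L → Matrix (Fin r) (Fin (T.r k)) ℝ →
      {B : TensorTrain ℝ σ n // B.r 0 = r}
  | k, 0, r, h, X =>
      ⟨TensorTrain.nil r (fun _ => 1) (fun α => (X * T.rightInterface k 0 h) α Fin.elim0), rfl⟩
  | k, 1, r, h, X =>
      ⟨(TensorTrain.nil 1 (fun _ => 1) (fun _ => 1)).cons (r₁ := 1) rfl
          (fun a => Matrix.of fun α (_ : Fin 1) => (X * T.rightInterface k 1 h) α (fun _ => a))
          (fun _ => 1), rfl⟩
  | k, n + 2, r, h, X =>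
      let p := lsel k r (T.r (k + 1)) (localStep X (T.core k))
      let rest := roundSweep lsel T (k + 1) (n + 1) p.1 (by omega)
        (p.2ᵀ * localStep X (T.core k) : Matrix (Fin p.1) (Fin (T.r (k + 1))) ℝ)
      ⟨rest.1.cons rest.2 (fun a => Matrix.of fun α β => p.2 (α, a) β) (fun _ => 1), rfl⟩

/-- THE ACCUMULATED LOCAL LOSS of the rounding sweep: the sum over the truncation sites of the
discarded parts `‖M̃ - U Uᵀ M̃‖²_F` of the local matrices (for the SVD rule: the discarded squared
singular values of `M̃`, `localSvdSel_loss_eq`).  [cite: Oseledets2011, §3, Alg. 2]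
[cite: Schollwoeck2011AnnPhys, §4.5.1] -/
noncomputable def roundLoss (lsel : LocalRule σ) {L : ℕ} (T : TensorTrain ℝ σ L) :
    (k n r : ℕ) → k + n = L → Matrix (Fin r) (Fin (T.r k)) ℝ → ℝ
  | _, 0, _, _, _ => 0
  | _, 1, _, _, _ => 0
  | k, n + 2, r, h, X =>
      let p := lsel k r (T.r (k + 1)) (localStep X (T.core k))
      (∑ q, ∑ γ, (localStep X (T.core k) - p.2 * (p.2ᵀ * localStep X (T.core k))) q γ ^ 2) +
        roundLoss lsel T (k + 1) (n + 1) p.1 (by omega)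
          (p.2ᵀ * localStep X (T.core k) : Matrix (Fin p.1) (Fin (T.r (k + 1))) ℝ)

/-- `ttRound lsel T`: TT-ROUNDING of the train `T` with the local rule `lsel` — the sweep started at
site `0` with the carried row vector `T.lbdry`.  [cite: Oseledets2011, §3, Alg. 2]
[cite: DaasEtAl2021, §2.3, Alg. "TT-Rounding"] [cite: UschmajewVandereycken2020, §3.2] -/
noncomputable def ttRound (lsel : LocalRule σ) {L : ℕ} (T : TensorTrain ℝ σ L) :
    TensorTrain ℝ σ L :=
  (roundSweep lsel T 0 L 1 (Nat.zero_add L) (Matrix.of fun (_ : Fin 1) α => T.lbdry α)).1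

/-- `ttRoundLoss lsel T`: the accumulated local loss of `ttRound lsel T`.
[cite: Oseledets2011, §3, Alg. 2] -/
noncomputable def ttRoundLoss (lsel : LocalRule σ) {L : ℕ} (T : TensorTrain ℝ σ L) : ℝ :=
  roundLoss lsel T 0 L 1 (Nat.zero_add L) (Matrix.of fun (_ : Fin 1) α => T.lbdry α)

/-- The sweep's train has left boundary vector `1`.  [cite: Oseledets2011, §3, Alg. 2] -/
theorem roundSweep_lbdry (lsel : LocalRule σ) {L : ℕ} (T : TensorTrain ℝ σ L) :
    ∀ (n k r : ℕ) (h : k + n = L) (X : Matrix (Fin r) (Fin (T.r k)) ℝ),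
      (roundSweep lsel T k n r h X).1.lbdry = fun _ => 1
  | 0, _, _, _, _ => rfl
  | 1, _, _, _, _ => rfl
  | _ + 2, _, _, _, _ => rfl

/-- The sweep's train has last bond dimension `1` (for `n ≥ 1`). [cite: Oseledets2011, §3, Alg. 2]
-/
theorem roundSweep_r_last (lsel : LocalRule σ) {L : ℕ} (T : TensorTrain ℝ σ L) :
    ∀ (n k r : ℕ) (h : k + n = L) (X : Matrix (Fin r) (Fin (T.r k)) ℝ), 0 < n →
      (roundSweep lsel T k n r h X).1.r n = 1
  | 0, _, _, _, _, hn => absurd hn (lt_irrefl 0)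
  | 1, _, _, _, _, _ => rfl
  | n + 2, k, r, h, X, _ => by
      rw [roundSweep]
      exact roundSweep_r_last lsel T (n + 1) (k + 1) _ _ _ (Nat.succ_pos n)

/-- The sweep's train has right boundary vector `1` (for `n ≥ 1`). [cite: Oseledets2011, §3, Alg. 2]
-/
theorem roundSweep_rbdry (lsel : LocalRule σ) {L : ℕ} (T : TensorTrain ℝ σ L) :
    ∀ (n k r : ℕ) (h : k + n = L) (X : Matrix (Fin r) (Fin (T.r k)) ℝ), 0 < n →
      (roundSweep lsel T k n r h X).1.rbdry = fun _ => 1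
  | 0, _, _, _, _, hn => absurd hn (lt_irrefl 0)
  | 1, _, _, _, _, _ => rfl
  | n + 2, k, r, h, X, _ => by
      rw [roundSweep]
      exact roundSweep_rbdry lsel T (n + 1) (k + 1) _ _ _ (Nat.succ_pos n)

/-- INTERIOR BOND DIMENSIONS of the sweep are the selected ones: if the rule never returns more than
`bd (k+1)` columns at site `k`, the bond `j` of the sweep started at site `k` is `≤ bd (k + j)`.
[cite: Oseledets2011, §3, Alg. 2] -/
theorem roundSweep_r_le (lsel : LocalRule σ) {L : ℕ} (T : TensorTrain ℝ σ L) (bd : ℕ → ℕ)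
    (hq : ∀ (k r : ℕ) (M : Matrix (Fin r × σ) (Fin (T.r (k + 1))) ℝ),
      (lsel k r (T.r (k + 1)) M).1 ≤ bd (k + 1)) :
    ∀ (n k r : ℕ) (h : k + n = L) (X : Matrix (Fin r) (Fin (T.r k)) ℝ) (j : ℕ), 0 < j → j < n →
      (roundSweep lsel T k n r h X).1.r j ≤ bd (k + j)
  | 0, _, _, _, _, j, _, hj => absurd hj (Nat.not_lt_zero j)
  | 1, _, _, _, _, _, _, _ => by omega
  | n + 2, k, r, h, X, j, hj0, hjn => by
      rw [roundSweep]
      match j, hj0, hjn with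
      | 1, _, _ =>
          show (roundSweep lsel T (k + 1) (n + 1) _ _ _).1.r 0 ≤ bd (k + 1)
          rw [(roundSweep lsel T (k + 1) (n + 1) _ _ _).2]
          exact hq k r _
      | j + 2, _, hjn =>
          show (roundSweep lsel T (k + 1) (n + 1) _ _ _).1.r (j + 1) ≤ bd (k + (j + 2))
          rw [show k + (j + 2) = k + 1 + (j + 1) by omega]
          exact roundSweep_r_le lsel T bd hq (n + 1) (k + 1) _ _ _ (j + 1) (Nat.succ_pos j)
            (by omega)

/-- [folklore] reshaping a matrix with orthonormal columns and row index `Fin r × σ` into a core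
`a ↦ U[(·, a), ·]` gives a left-orthonormal core. -/
private theorem sum_transpose_mul_self_reshape {r q q' : ℕ} (U : Matrix (Fin r × σ) (Fin q) ℝ)
    (hU : Uᵀ * U = 1) (h : q' = q) :
    ∑ a, (Matrix.of fun α (β : Fin q') =>
        (Matrix.of fun α' β' => U (α', a) β' : Matrix (Fin r) (Fin q) ℝ) α (β.cast h))ᵀ *
      (Matrix.of fun α (β : Fin q') =>
        (Matrix.of fun α' β' => U (α', a) β' : Matrix (Fin r) (Fin q) ℝ) α (β.cast h)) = 1 := by
  subst h
  ext β β'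
  have h1 := congrFun (congrFun hU β) β'
  rw [Matrix.mul_apply, Fintype.sum_prod_type] at h1
  rw [Matrix.sum_apply]
  simp only [Matrix.mul_apply, Matrix.transpose_apply, Matrix.of_apply, Fin.cast_eq_self] at h1 ⊢
  rw [Finset.sum_comm]
  exact h1

/-- THE OUTPUT IS LEFT-ORTHONORMAL: if the rule always returns orthonormal columns (`Uᵀ U = 1`),
every core of the sweep except the last satisfies `∑ a, B_j(a)ᵀ B_j(a) = 1`.
[cite: Oseledets2011, §3, Alg. 2] [cite: HoltzRohwedderSchneider2011, §3] -/
theorem roundSweep_transpose_core_mul_core (lsel : LocalRule σ) {L : ℕ} (T : TensorTrain ℝ σ L)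
    (hsel : ∀ (k r : ℕ) (M : Matrix (Fin r × σ) (Fin (T.r (k + 1))) ℝ),
      (lsel k r (T.r (k + 1)) M).2ᵀ * (lsel k r (T.r (k + 1)) M).2 = 1) :
    ∀ (n k r : ℕ) (h : k + n = L) (X : Matrix (Fin r) (Fin (T.r k)) ℝ) (j : ℕ), j + 1 < n →
      ∑ a, ((roundSweep lsel T k n r h X).1.core j a)ᵀ *
        (roundSweep lsel T k n r h X).1.core j a = 1
  | 0, _, _, _, _, _, hj => absurd hj (by omega)
  | 1, _, _, _, _, _, hj => absurd hj (by omega)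
  | n + 2, k, r, h, X, 0, _ => by
      have hc := (roundSweep lsel T (k + 1) (n + 1)
        (lsel k r (T.r (k + 1)) (localStep X (T.core k))).1 (by omega)
        ((lsel k r (T.r (k + 1)) (localStep X (T.core k))).2ᵀ * localStep X (T.core k) :
          Matrix (Fin (lsel k r (T.r (k + 1)) (localStep X (T.core k))).1)
            (Fin (T.r (k + 1))) ℝ)).2
      rw [roundSweep]
      exact sum_transpose_mul_self_reshape _ (hsel k r (localStep X (T.core k))) hc
  | n + 2, k, r, h, X, j + 1, hj => by
      rw [roundSweep]
      exact roundSweep_transpose_core_mul_core lsel T hsel (n + 1) (k + 1) _ _ _ j (by omega)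

/-- `ttRound` keeps the left bond dimension: `(ttRound lsel T).r 0 = 1`.
[cite: Oseledets2011, §3, Alg. 2] -/
theorem ttRound_r_zero (lsel : LocalRule σ) {L : ℕ} (T : TensorTrain ℝ σ L) :
    (ttRound lsel T).r 0 = 1 :=
  (roundSweep lsel T 0 L 1 (Nat.zero_add L) _).2

/-- `ttRound` has left boundary vector `1`.  [cite: Oseledets2011, §3, Alg. 2] -/
theorem ttRound_lbdry (lsel : LocalRule σ) {L : ℕ} (T : TensorTrain ℝ σ L) :
    (ttRound lsel T).lbdry = fun _ => 1 :=
  roundSweep_lbdry lsel T L 0 1 (Nat.zero_add L) _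

/-- `ttRound` has last bond dimension `1` (`L ≥ 1`).  [cite: Oseledets2011, §3, Alg. 2] -/
theorem ttRound_r_last (lsel : LocalRule σ) {L : ℕ} (T : TensorTrain ℝ σ L) (hL : 0 < L) :
    (ttRound lsel T).r L = 1 :=
  roundSweep_r_last lsel T L 0 1 (Nat.zero_add L) _ hL

/-- `ttRound` has right boundary vector `1` (`L ≥ 1`).  [cite: Oseledets2011, §3, Alg. 2] -/
theorem ttRound_rbdry (lsel : LocalRule σ) {L : ℕ} (T : TensorTrain ℝ σ L) (hL : 0 < L) :
    (ttRound lsel T).rbdry = fun _ => 1 :=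
  roundSweep_rbdry lsel T L 0 1 (Nat.zero_add L) _ hL

/-- `ttRound` is left-orthonormal at the sites `j + 1 < L` when the rule returns orthonormal
columns. [cite: Oseledets2011, §3, Alg. 2] [cite: HoltzRohwedderSchneider2011, §3] -/
theorem ttRound_transpose_core_mul_core (lsel : LocalRule σ) {L : ℕ} (T : TensorTrain ℝ σ L)
    (hsel : ∀ (k r : ℕ) (M : Matrix (Fin r × σ) (Fin (T.r (k + 1))) ℝ),
      (lsel k r (T.r (k + 1)) M).2ᵀ * (lsel k r (T.r (k + 1)) M).2 = 1)
    (j : ℕ) (hj : j + 1 < L) :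
    ∑ a, ((ttRound lsel T).core j a)ᵀ * (ttRound lsel T).core j a = 1 :=
  roundSweep_transpose_core_mul_core lsel T hsel L 0 1 (Nat.zero_add L) _ j hj

/-! ## Locality: the rounding sweep is the TT-SVD sweep of the full tensor -/

omit [Fintype σ] in
/-- THE STEP MATRIX FACTORS THROUGH THE LOCAL MATRIX.  If the coefficient function handed to the
TT-SVD step is `C = X · Q_k` (`Q_k = T.rightInterface k (n+1)`, the tail interface), then the matrix
the TT-SVD decomposes, `stepMatrix C` (`(r·|σ|) × |σ|^n`), equals `localStep X G_k · Q_{k+1}`.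
[cite: Oseledets2011, §3] [cite: UschmajewVandereycken2020, §3.2] -/
theorem stepMatrix_eq_localStep_mul {L k n r : ℕ} (T : TensorTrain ℝ σ L) (h : k + (n + 1) = L)
    (h' : k + 1 + n = L) (X : Matrix (Fin r) (Fin (T.r k)) ℝ)
    (C : Fin r → (Fin (n + 1) → σ) → ℝ)
    (hC : ∀ β t, C β t = (X * T.rightInterface k (n + 1) h) β t) :
    stepMatrix C = localStep X (T.core k) * T.rightInterface (k + 1) n h' := by
  ext ⟨α, a⟩ t
  simp only [stepMatrix, localStep, Matrix.of_apply, hC, Matrix.mul_apply,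
    TensorTrain.rightInterface_cons, Finset.mul_sum, Finset.sum_mul, mul_assoc]
  rw [Finset.sum_comm]

/-- `roundSweep = ttSweep` (LOCALITY OF TT-ROUNDING).  Let `gsel` be a selection rule for the TT-SVD
sweep of `TensorTrainSVD` which, on every matrix of the form `M̃ · Q_{k+1}` (`Q_{k+1}` a tail
interface of `T`), returns what the local rule `lsel` returns on `M̃`.  Then the rounding sweep of
`T` carrying `X` coincides — as a train, bond dimensions included — with the TT-SVD sweep of the
coefficient function `X · Q_k`.  [cite: Oseledets2011, §3, Alg. 2]
[cite: UschmajewVandereycken2020, §3.2] -/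
theorem roundSweep_eq_ttSweep (lsel : LocalRule σ) (gsel : SelectionRule σ) {L : ℕ}
    (T : TensorTrain ℝ σ L)
    (hext : ∀ (k r m : ℕ) (h : k + 1 + m = L) (M : Matrix (Fin r × σ) (Fin (T.r (k + 1))) ℝ),
      gsel k r m (M * T.rightInterface (k + 1) m h) = lsel k r (T.r (k + 1)) M) :
    ∀ (n k r : ℕ) (h : k + n = L) (X : Matrix (Fin r) (Fin (T.r k)) ℝ)
      (C : Fin r → (Fin n → σ) → ℝ), (∀ β t, C β t = (X * T.rightInterface k n h) β t) →
        roundSweep lsel T k n r h X = ttSweep gsel k n r C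
  | 0, k, r, h, X, C, hC => by
      rw [roundSweep, ttSweep]
      simp only [hC]
  | 1, k, r, h, X, C, hC => by
      rw [roundSweep, ttSweep]
      simp only [hC]
  | n + 2, k, r, h, X, C, hC => by
      have h' : k + 1 + (n + 1) = L := by omega
      have hM := stepMatrix_eq_localStep_mul T h h' X C hC
      have hp : gsel k r (n + 1) (stepMatrix C) =
          lsel k r (T.r (k + 1)) (localStep X (T.core k)) := by
        rw [hM]; exact hext k r (n + 1) h' _
      have ih := fun (q : ℕ) (U : Matrix (Fin r × σ) (Fin q) ℝ) =>
        roundSweep_eq_ttSweep lsel gsel T hext (n + 1) (k + 1) q h'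
          (Uᵀ * localStep X (T.core k)) (Uᵀ * stepMatrix C)
          (fun β t => by rw [hM, Matrix.mul_assoc])
      rw [roundSweep, ttSweep]
      simp only [ih]
      -- transport along `hp` (the bond dimension `q` is a dependent index, so `rw` cannot do it)
      exact congrArg (fun y : (q : ℕ) × Matrix (Fin r × σ) (Fin q) ℝ =>
        (⟨(ttSweep gsel (k + 1) (n + 1) y.1 (y.2ᵀ * stepMatrix C)).1.cons
            (ttSweep gsel (k + 1) (n + 1) y.1 (y.2ᵀ * stepMatrix C)).2
            (fun a => Matrix.of fun α β => y.2 (α, a) β) (fun _ => 1), rfl⟩ :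
          {B : TensorTrain ℝ σ (n + 2) // B.r 0 = r})) hp.symm

/-- `sweepLoss = roundLoss`: under the same compatibility, and if the tail interfaces `Q_{k+1}` have
orthonormal rows, the accumulated loss of the TT-SVD sweep (`sweepLoss` of `TensorTrainSVD`,
measured on the `|σ|^{n}`-column step matrices) equals the accumulated LOCAL loss of the rounding
sweep. [cite: Oseledets2011, §3, Alg. 2] [cite: Schollwoeck2011AnnPhys, §4.5.1] -/
theorem sweepLoss_eq_roundLoss (lsel : LocalRule σ) (gsel : SelectionRule σ) {L : ℕ}
    (T : TensorTrain ℝ σ L)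
    (hext : ∀ (k r m : ℕ) (h : k + 1 + m = L) (M : Matrix (Fin r × σ) (Fin (T.r (k + 1))) ℝ),
      gsel k r m (M * T.rightInterface (k + 1) m h) = lsel k r (T.r (k + 1)) M)
    (hQ : ∀ (k m : ℕ) (h : k + 1 + m = L),
      T.rightInterface (k + 1) m h * (T.rightInterface (k + 1) m h)ᵀ = 1) :
    ∀ (n k r : ℕ) (h : k + n = L) (X : Matrix (Fin r) (Fin (T.r k)) ℝ)
      (C : Fin r → (Fin n → σ) → ℝ), (∀ β t, C β t = (X * T.rightInterface k n h) β t) →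
        sweepLoss gsel k n r C = roundLoss lsel T k n r h X
  | 0, _, _, _, _, _, _ => by rw [sweepLoss, roundLoss]
  | 1, _, _, _, _, _, _ => by rw [sweepLoss, roundLoss]
  | n + 2, k, r, h, X, C, hC => by
      have h' : k + 1 + (n + 1) = L := by omega
      have hM := stepMatrix_eq_localStep_mul T h h' X C hC
      have hp : gsel k r (n + 1) (stepMatrix C) =
          lsel k r (T.r (k + 1)) (localStep X (T.core k)) := by
        rw [hM]; exact hext k r (n + 1) h' _
      have ih := fun (q : ℕ) (U : Matrix (Fin r × σ) (Fin q) ℝ) =>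
        sweepLoss_eq_roundLoss lsel gsel T hext hQ (n + 1) (k + 1) q h'
          (Uᵀ * localStep X (T.core k)) (Uᵀ * stepMatrix C)
          (fun β t => by rw [hM, Matrix.mul_assoc])
      have e : ∀ (q : ℕ) (U : Matrix (Fin r × σ) (Fin q) ℝ),
          localStep X (T.core k) * T.rightInterface (k + 1) (n + 1) h' -
              U * (Uᵀ * (localStep X (T.core k) * T.rightInterface (k + 1) (n + 1) h')) =
            (localStep X (T.core k) - U * (Uᵀ * localStep X (T.core k))) *
              T.rightInterface (k + 1) (n + 1) h' := by
        intro q U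
        rw [Matrix.sub_mul, Matrix.mul_assoc, Matrix.mul_assoc]
      rw [sweepLoss, roundLoss, hp, ih, hM, e,
        sum_sq_mul_of_mul_transpose_self_eq_one _ (hQ k (n + 1) h')]

/-! ## The SVD rule and its lift -/

/-- THE LOCAL SVD RULE with rank caps `rk`: at site `k` choose `q = min (rk (k+1)) n` orthonormal
columns `U` spanning a dominant singular subspace of the local matrix (optimal rank-`q` projection,
from `exists_orthonormalCols_proj_optimal`).  [cite: Oseledets2011, §3, Alg. 2]
[cite: GolubVanLoan2013, §2.4.2] -/
noncomputable def localSvdSel (rk : ℕ → ℕ) (k r n : ℕ) (M : Matrix (Fin r × σ) (Fin n) ℝ) :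
    (q : ℕ) × Matrix (Fin r × σ) (Fin q) ℝ :=
  Classical.choose (exists_orthonormalCols_proj_optimal M (min (rk (k + 1)) n))

/-- Specification of the local SVD rule: `q ≤ min (rk (k+1)) n`, `Uᵀ U = 1`, and `U Uᵀ M̃` is an
optimal approximation of `M̃` among all matrices of rank `≤ rk (k+1)`.
[cite: GolubVanLoan2013, §2.4.2] [cite: Oseledets2011, §3, Alg. 2] -/
theorem localSvdSel_spec (rk : ℕ → ℕ) (k r n : ℕ) (M : Matrix (Fin r × σ) (Fin n) ℝ) :
    (localSvdSel rk k r n M).1 ≤ min (rk (k + 1)) n ∧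
      (localSvdSel rk k r n M).2ᵀ * (localSvdSel rk k r n M).2 = 1 ∧
      ∀ R : Matrix (Fin r × σ) (Fin n) ℝ, R.rank ≤ rk (k + 1) →
        ∑ q, ∑ γ, (M - (localSvdSel rk k r n M).2 * ((localSvdSel rk k r n M).2ᵀ * M)) q γ ^ 2 ≤
          ∑ q, ∑ γ, (M - R) q γ ^ 2 := by
  obtain ⟨h1, h2, h3⟩ :=
    Classical.choose_spec (exists_orthonormalCols_proj_optimal M (min (rk (k + 1)) n))
  exact ⟨h1, h2, fun R hR =>
    h3 R (le_min hR ((Matrix.rank_le_card_width R).trans (Fintype.card_fin n).le))⟩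

/-- THE LOCAL LOSS IS THE DISCARDED TAIL: for the SVD rule, `‖M̃ - U Uᵀ M̃‖²_F` is the sum of the
squared singular values of the local matrix `M̃` of index `≥ rk (k+1)`.
[cite: GolubVanLoan2013, §2.4.2] [cite: Schollwoeck2011AnnPhys, §4.5.1] -/
theorem localSvdSel_loss_eq (rk : ℕ → ℕ) (k r n : ℕ) (M : Matrix (Fin r × σ) (Fin n) ℝ) :
    ∑ q, ∑ γ, (M - (localSvdSel rk k r n M).2 * ((localSvdSel rk k r n M).2ᵀ * M)) q γ ^ 2 =
      ∑ j ∈ Finset.Ico (rk (k + 1)) n, (Matrix.toEuclideanLin M).singularValues j ^ 2 := by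
  classical
  have hnorm : ∀ A : Matrix (Fin r × σ) (Fin n) ℝ,
      ∑ i, ∑ j, ‖A i j‖ ^ 2 = ∑ i, ∑ j, A i j ^ 2 := fun A => by
    simp only [Real.norm_eq_abs, sq_abs]
  obtain ⟨hq, hU, hopt⟩ := localSvdSel_spec rk k r n M
  apply le_antisymm
  · obtain ⟨B, hB, -, hBF⟩ :=
      Literature.LinearAlgebra.Matrix.exists_rank_le_sum_sq_norm_entry_sub_eq M (rk (k + 1))
    rw [hnorm, Fintype.card_fin] at hBF
    rw [← hBF]
    exact hopt B hB
  · have hrank : ((localSvdSel rk k r n M).2 * ((localSvdSel rk k r n M).2ᵀ * M)).rank ≤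
        rk (k + 1) :=
      (Matrix.rank_mul_le_left _ _).trans
        (((Matrix.rank_le_card_width _).trans (Fintype.card_fin _).le).trans
          (hq.trans (min_le_left _ _)))
    have h := Literature.LinearAlgebra.Matrix.sum_Ico_sq_singularValues_le_sum_sq_norm_entry_sub
      M _ hrank
    rw [hnorm, Fintype.card_fin] at h
    exact h

/-- `ttRound (localSvdSel rk) T` has bond dimensions `≤ min (rk k) (T.r k)` at the interior bonds:
rounding caps the bonds at `rk` and never increases a bond.  [cite: Oseledets2011, §3, Alg. 2]
[cite: UschmajewVandereycken2020, §3.2] -/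
theorem ttRound_r_le (rk : ℕ → ℕ) {L : ℕ} (T : TensorTrain ℝ σ L) (k : ℕ) (hk : 0 < k)
    (hkL : k < L) : (ttRound (localSvdSel rk) T).r k ≤ min (rk k) (T.r k) := by
  have h := roundSweep_r_le (localSvdSel rk) T (fun i => min (rk i) (T.r i))
    (fun k r M => (localSvdSel_spec rk k r _ M).1) L 0 1 (Nat.zero_add L)
    (Matrix.of fun (_ : Fin 1) α => T.lbdry α) k hk hkL
  rwa [Nat.zero_add] at h

/-- `ttRound (localSvdSel rk) T` is left-orthonormal at the sites `j + 1 < L`.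
[cite: Oseledets2011, §3, Alg. 2] [cite: HoltzRohwedderSchneider2011, §3] -/
theorem ttRound_localSvdSel_transpose_core_mul_core (rk : ℕ → ℕ) {L : ℕ} (T : TensorTrain ℝ σ L)
    (j : ℕ) (hj : j + 1 < L) :
    ∑ a, ((ttRound (localSvdSel rk) T).core j a)ᵀ * (ttRound (localSvdSel rk) T).core j a = 1 :=
  ttRound_transpose_core_mul_core (localSvdSel rk) T
    (fun k r M => (localSvdSel_spec rk k r _ M).2.1) j hj

variable [DecidableEq σ]

open Classical in
/-- THE LIFTED SELECTION RULE for the TT-SVD sweep of `TensorTrainSVD`: on a matrix `M` whose rows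
lie in the row space of the tail interface `Q_{k+1}` of `T` (`M Q_{k+1}ᵀ Q_{k+1} = M`) apply the
local SVD rule to the small matrix `M Q_{k+1}ᵀ`; on any other matrix fall back to the global SVD
rule `svdSel`. [cite: Oseledets2011, §3, Alg. 2] [cite: UschmajewVandereycken2020, §3.2] -/
noncomputable def liftSel (rk : ℕ → ℕ) {L : ℕ} (T : TensorTrain ℝ σ L) (k r m : ℕ)
    (M : Matrix (Fin r × σ) (Fin m → σ) ℝ) : (q : ℕ) × Matrix (Fin r × σ) (Fin q) ℝ :=
  if e : k + 1 + m = L then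
    if M * (T.rightInterface (k + 1) m e)ᵀ * T.rightInterface (k + 1) m e = M then
      localSvdSel rk k r (T.r (k + 1)) (M * (T.rightInterface (k + 1) m e)ᵀ)
    else svdSel rk k r m M
  else svdSel rk k r m M

/-- On matrices `M̃ · Q_{k+1}` with `Q_{k+1} Q_{k+1}ᵀ = 1` the lifted rule IS the local rule applied
to `M̃`. [cite: Oseledets2011, §3, Alg. 2] -/
theorem liftSel_apply_mul (rk : ℕ → ℕ) {L : ℕ} (T : TensorTrain ℝ σ L) {k m : ℕ}
    (e : k + 1 + m = L)
    (hQ : T.rightInterface (k + 1) m e * (T.rightInterface (k + 1) m e)ᵀ = 1) (r : ℕ)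
    (M : Matrix (Fin r × σ) (Fin (T.r (k + 1))) ℝ) :
    liftSel rk T k r m (M * T.rightInterface (k + 1) m e) = localSvdSel rk k r (T.r (k + 1)) M := by
  have h1 : M * T.rightInterface (k + 1) m e * (T.rightInterface (k + 1) m e)ᵀ = M := by
    rw [Matrix.mul_assoc, hQ, Matrix.mul_one]
  have hc : M * T.rightInterface (k + 1) m e * (T.rightInterface (k + 1) m e)ᵀ *
      T.rightInterface (k + 1) m e = M * T.rightInterface (k + 1) m e := by
    rw [h1]
  unfold liftSel
  rw [dif_pos e, if_pos hc, h1]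

/-- Case analysis of the lifted rule: either the local branch fires (the rows of `M` lie in the row
space of a tail interface) or the rule is the global SVD rule.  [cite: Oseledets2011, §3, Alg. 2] -/
theorem liftSel_eq (rk : ℕ → ℕ) {L : ℕ} (T : TensorTrain ℝ σ L) (k r m : ℕ)
    (M : Matrix (Fin r × σ) (Fin m → σ) ℝ) :
    (∃ e : k + 1 + m = L,
        M * (T.rightInterface (k + 1) m e)ᵀ * T.rightInterface (k + 1) m e = M ∧
          liftSel rk T k r m M =
            localSvdSel rk k r (T.r (k + 1)) (M * (T.rightInterface (k + 1) m e)ᵀ)) ∨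
      liftSel rk T k r m M = svdSel rk k r m M := by
  unfold liftSel
  by_cases e : k + 1 + m = L
  · by_cases hM : M * (T.rightInterface (k + 1) m e)ᵀ * T.rightInterface (k + 1) m e = M
    · exact Or.inl ⟨e, hM, by rw [dif_pos e, if_pos hM]⟩
    · exact Or.inr (by rw [dif_pos e, if_neg hM])
  · exact Or.inr (by rw [dif_neg e])

/-- The lifted rule selects at most `rk (k+1)` columns.  [cite: Oseledets2011, §3, Alg. 2] -/
theorem liftSel_fst_le (rk : ℕ → ℕ) {L : ℕ} (T : TensorTrain ℝ σ L) (k r m : ℕ)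
    (M : Matrix (Fin r × σ) (Fin m → σ) ℝ) : (liftSel rk T k r m M).1 ≤ rk (k + 1) := by
  rcases liftSel_eq rk T k r m M with ⟨e, -, h⟩ | h
  · rw [h]
    exact (localSvdSel_spec rk k r (T.r (k + 1)) (M * (T.rightInterface (k + 1) m e)ᵀ)).1.trans
      (min_le_left _ _)
  · rw [h]
    exact (svdSel_spec rk k r m M).1

/-- The lifted rule selects orthonormal columns.  [cite: Oseledets2011, §3, Alg. 2] -/
theorem liftSel_orthonormal (rk : ℕ → ℕ) {L : ℕ} (T : TensorTrain ℝ σ L) (k r m : ℕ)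
    (M : Matrix (Fin r × σ) (Fin m → σ) ℝ) :
    (liftSel rk T k r m M).2ᵀ * (liftSel rk T k r m M).2 = 1 := by
  rcases liftSel_eq rk T k r m M with ⟨e, -, h⟩ | h
  · rw [h]
    exact (localSvdSel_spec rk k r (T.r (k + 1)) (M * (T.rightInterface (k + 1) m e)ᵀ)).2.1
  · rw [h]
    exact (svdSel_spec rk k r m M).2.1

/-- THE LIFTED RULE IS OPTIMAL on every matrix, provided `T` is right-orthonormal at the sites
`0 < j < L` with `r_L = 1` and right boundary vector `1` (so that every tail interface `Q_{k+1}` has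
orthonormal rows, `TensorTrain.rightInterface_mul_transpose_self`): `‖M - U Uᵀ M‖_F ≤ ‖M - R‖_F` for
all `R` of rank `≤ rk (k+1)` — by the locality lemma `sum_sq_sub_proj_le_of_mul_transpose_mul` on
the local branch and by Eckart–Young (`svdSel_spec`) on the fallback branch.
[cite: Oseledets2011, §3, Alg. 2] [cite: GolubVanLoan2013, §2.4.2] -/
theorem liftSel_optimal (rk : ℕ → ℕ) {L : ℕ} (T : TensorTrain ℝ σ L) (hL : T.r L = 1)
    (hrb : T.rbdry = fun _ => 1)
    (hright : ∀ j, 0 < j → j < L → ∑ a, T.core j a * (T.core j a)ᵀ = 1)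
    (k r m : ℕ) (M R : Matrix (Fin r × σ) (Fin m → σ) ℝ) (hR : R.rank ≤ rk (k + 1)) :
    ∑ q, ∑ t, (M - (liftSel rk T k r m M).2 * ((liftSel rk T k r m M).2ᵀ * M)) q t ^ 2 ≤
      ∑ q, ∑ t, (M - R) q t ^ 2 := by
  rcases liftSel_eq rk T k r m M with ⟨e, hM, h⟩ | h
  · rw [h]
    exact sum_sq_sub_proj_le_of_mul_transpose_mul _
      (T.rightInterface_mul_transpose_self hL hrb m (k + 1) e
        fun j hj hjL => hright j (by omega) hjL)
      M hM _ (rk (k + 1))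
      (localSvdSel_spec rk k r (T.r (k + 1)) (M * (T.rightInterface (k + 1) m e)ᵀ)).2.2 R hR
  · rw [h]
    exact (svdSel_spec rk k r m M).2.2 R hR

/-! ## Guarantees for right-orthonormal input -/

omit [Fintype σ] [DecidableEq σ] in
/-- The full tensor read through the interface at bond `0`: `T(t) = (lbdry · Q_0)[t]` with
`Q_0 = T.rightInterface 0 L`. [cite: UschmajewVandereycken2020, §3.2] -/
theorem eval_eq_lbdry_mul_rightInterface {L : ℕ} (T : TensorTrain ℝ σ L) (β : Fin 1)
    (t : Fin L → σ) :
    T.eval t = ((Matrix.of fun (_ : Fin 1) α => T.lbdry α) *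
      T.rightInterface 0 L (Nat.zero_add L)) β t := by
  have h1 := T.eval_append 0 L (Nat.zero_add L) Fin.elim0 t
  simp only [Fin.elim0_append, TensorTrain.leftInterface_zero] at h1
  rw [Matrix.mul_apply]
  simp only [Matrix.of_apply]
  refine Eq.trans ?_ h1
  rfl

/-- `roundSweep = ttSweep` for the SVD rule on right-orthonormal input (with the bookkeeping
`r_0 = 1` proofs): the rounding sweep started at site `0` with the row vector `T.lbdry` is the
TT-SVD sweep of the full tensor `T.eval` with the lifted selection rule `liftSel rk T`.
[cite: Oseledets2011, §3, Alg. 2] [cite: UschmajewVandereycken2020, §3.2] -/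
theorem roundSweep_localSvdSel_eq_ttSweep (rk : ℕ → ℕ) {L : ℕ} (T : TensorTrain ℝ σ L)
    (hL : T.r L = 1) (hrb : T.rbdry = fun _ => 1)
    (hright : ∀ j, 0 < j → j < L → ∑ a, T.core j a * (T.core j a)ᵀ = 1) :
    roundSweep (localSvdSel rk) T 0 L 1 (Nat.zero_add L)
        (Matrix.of fun (_ : Fin 1) α => T.lbdry α) =
      ttSweep (liftSel rk T) 0 L 1 (fun _ => T.eval) :=
  roundSweep_eq_ttSweep (localSvdSel rk) (liftSel rk T) T
    (fun k r m h M => liftSel_apply_mul rk T h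
      (T.rightInterface_mul_transpose_self hL hrb m (k + 1) h
        fun j hj hjL => hright j (by omega) hjL) r M)
    L 0 1 (Nat.zero_add L) _ _ (eval_eq_lbdry_mul_rightInterface T)

/-- `ttRound = ttSVD-sweep`: for the SVD rule on right-orthonormal input, TT-rounding of `T` IS the
TT-SVD sweep (`ttSweep` of `TensorTrainSVD`) of the full tensor `T.eval` with the lifted
selection rule `liftSel rk T` — the algorithm on the cores computes what the algorithm on the
`|σ|^L` entries would.  [cite: Oseledets2011, §3, Alg. 2] [cite: UschmajewVandereycken2020, §3.2] -/
theorem ttRound_eq_ttSweep (rk : ℕ → ℕ) {L : ℕ} (T : TensorTrain ℝ σ L) (hL : T.r L = 1)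
    (hrb : T.rbdry = fun _ => 1)
    (hright : ∀ j, 0 < j → j < L → ∑ a, T.core j a * (T.core j a)ᵀ = 1) :
    ttRound (localSvdSel rk) T = (ttSweep (liftSel rk T) 0 L 1 (fun _ => T.eval)).1 :=
  congrArg Subtype.val (roundSweep_localSvdSel_eq_ttSweep rk T hL hrb hright)

/-- A-POSTERIORI ERROR IDENTITY. For right-orthonormal input the squared error of TT-rounding is
EXACTLY the accumulated local loss: `‖T - ttRound (localSvdSel rk) T‖²_F = ttRoundLoss`, the sum
over the sweep of the discarded squared singular values of the (truncation-dependent) local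
matrices. [cite: Oseledets2011, §3, Alg. 2] [cite: Schollwoeck2011AnnPhys, §4.5.1] -/
theorem sum_sq_sub_eval_ttRound_eq_loss (rk : ℕ → ℕ) {L : ℕ} (T : TensorTrain ℝ σ L)
    (hL : T.r L = 1) (hrb : T.rbdry = fun _ => 1)
    (hright : ∀ j, 0 < j → j < L → ∑ a, T.core j a * (T.core j a)ᵀ = 1) :
    ∑ s, (T.eval s - (ttRound (localSvdSel rk) T).eval s) ^ 2 = ttRoundLoss (localSvdSel rk) T := by
  have hQ : ∀ (k m : ℕ) (h : k + 1 + m = L),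
      T.rightInterface (k + 1) m h * (T.rightInterface (k + 1) m h)ᵀ = 1 :=
    fun k m h => T.rightInterface_mul_transpose_self hL hrb m (k + 1) h
      fun j hj hjL => hright j (by omega) hjL
  have hext : ∀ (k r m : ℕ) (h : k + 1 + m = L) (M : Matrix (Fin r × σ) (Fin (T.r (k + 1))) ℝ),
      liftSel rk T k r m (M * T.rightInterface (k + 1) m h) = localSvdSel rk k r (T.r (k + 1)) M :=
    fun k r m h M => liftSel_apply_mul rk T h (hQ k m h) r M
  calc ∑ s, (T.eval s - (ttRound (localSvdSel rk) T).eval s) ^ 2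
      = ∑ α : Fin 1, ∑ s, (T.eval s -
          (ttSweep (liftSel rk T) 0 L 1 (fun _ => T.eval)).1.evalAt
            (ttSweep (liftSel rk T) 0 L 1 (fun _ => T.eval)).2 α s) ^ 2 := by
        rw [Fin.sum_univ_one, ttRound_eq_ttSweep rk T hL hrb hright]
        simp only [TensorTrain.eval_eq_evalAt _ (ttSweep (liftSel rk T) 0 L 1 _).2
          (ttSweep_lbdry (liftSel rk T) 0 L 1 _)]
    _ = sweepLoss (liftSel rk T) 0 L 1 (fun _ => T.eval) :=
        sum_sq_sub_evalAt_ttSweep (liftSel rk T) (liftSel_orthonormal rk T) L 0 1 _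
    _ = ttRoundLoss (localSvdSel rk) T :=
        sweepLoss_eq_roundLoss (localSvdSel rk) (liftSel rk T) T hext hQ L 0 1 (Nat.zero_add L) _ _
          (eval_eq_lbdry_mul_rightInterface T)

/-- ERROR BOUND OF TT-ROUNDING (the TT-SVD bound, for Algorithm 2): for right-orthonormal input,
if every unfolding `T_⟨k⟩`, `0 < k < L`, is within squared Frobenius distance `b k` of a matrix of
rank `≤ rk k`, then `‖T - ttRound (localSvdSel rk) T‖²_F ≤ ∑_{0<k<L} b k` (so with
`b k = ε₀² ‖T‖² / (L-1)`: "the resulting tensor satisfies `‖X - Y‖ ≤ ε₀ ‖X‖`").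
[cite: Oseledets2011, §2–§3] [cite: OseledetsTyrtyshnikov2010, Thm 2.2]
[cite: DaasEtAl2021, §2.3, Alg. "TT-Rounding"] [cite: UschmajewVandereycken2020, §3.2] -/
theorem sum_sq_sub_eval_ttRound_le (rk : ℕ → ℕ) {L : ℕ} (T : TensorTrain ℝ σ L)
    (hL : T.r L = 1) (hrb : T.rbdry = fun _ => 1)
    (hright : ∀ j, 0 < j → j < L → ∑ a, T.core j a * (T.core j a)ᵀ = 1) (b : ℕ → ℝ)
    (hb : ∀ (k m : ℕ) (h : k + m = L), 0 < k → 0 < m →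
      ∃ R : Matrix (Fin k → σ) (Fin m → σ) ℝ, R.rank ≤ rk k ∧
        ∑ s, ∑ t, (T.evalUnfolding k m h - R) s t ^ 2 ≤ b k) :
    ∑ s, (T.eval s - (ttRound (localSvdSel rk) T).eval s) ^ 2 ≤ ∑ k ∈ Finset.Ico 1 L, b k := by
  have hW₀ : (Matrix.of fun (_ : Fin 0 → σ) (_ : Fin 1) => (1 : ℝ))ᵀ *
      Matrix.of (fun (_ : Fin 0 → σ) (_ : Fin 1) => (1 : ℝ)) = 1 := by
    ext i j
    obtain rfl : i = j := Subsingleton.elim _ _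
    rw [Matrix.mul_apply, Fintype.sum_unique]
    simp
  have hC₀ : ∀ (β : Fin 1) (t : Fin L → σ), T.eval t =
      ((Matrix.of fun (_ : Fin 0 → σ) (_ : Fin 1) => (1 : ℝ))ᵀ *
        unfolding T.eval 0 L (Nat.zero_add L)) β t := by
    intro β t
    rw [Matrix.mul_apply, Fintype.sum_unique]
    simp only [Matrix.transpose_apply, Matrix.of_apply, one_mul, unfolding]
    rw [Fin.append_left_nil _ _ rfl]
    rfl
  calc ∑ s, (T.eval s - (ttRound (localSvdSel rk) T).eval s) ^ 2
      = ∑ α : Fin 1, ∑ s, (T.eval s -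
          (ttSweep (liftSel rk T) 0 L 1 (fun _ => T.eval)).1.evalAt
            (ttSweep (liftSel rk T) 0 L 1 (fun _ => T.eval)).2 α s) ^ 2 := by
        rw [Fin.sum_univ_one, ttRound_eq_ttSweep rk T hL hrb hright]
        simp only [TensorTrain.eval_eq_evalAt _ (ttSweep (liftSel rk T) 0 L 1 _).2
          (ttSweep_lbdry (liftSel rk T) 0 L 1 _)]
    _ = sweepLoss (liftSel rk T) 0 L 1 (fun _ => T.eval) :=
        sum_sq_sub_evalAt_ttSweep (liftSel rk T) (liftSel_orthonormal rk T) L 0 1 _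
    _ ≤ ∑ k ∈ Finset.Ico (0 + 1) (0 + L), b k :=
        sweepLoss_le T.eval rk b hb (liftSel rk T) (liftSel_orthonormal rk T)
          (liftSel_optimal rk T hL hrb hright) L 0 1 (Nat.zero_add L) (fun _ => T.eval)
          (Matrix.of fun _ _ => 1) hW₀ hC₀
    _ = ∑ k ∈ Finset.Ico 1 L, b k := by rw [Nat.zero_add, Nat.zero_add]

/-- ERROR BOUND BY SINGULAR VALUES: for right-orthonormal input,
`‖T - ttRound (localSvdSel rk) T‖²_F ≤ ∑_{0<k<L} ∑_{j ≥ rk k} σ_j(T_⟨k⟩)²`, the discarded tails of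
the unfoldings of the ORIGINAL tensor. [cite: Oseledets2011, §2–§3]
[cite: OseledetsTyrtyshnikov2010, Thm 2.2] [cite: GolubVanLoan2013, §2.4.2] -/
theorem sum_sq_sub_eval_ttRound_le_of_singularValues (rk : ℕ → ℕ) {L : ℕ} (T : TensorTrain ℝ σ L)
    (hL : T.r L = 1) (hrb : T.rbdry = fun _ => 1)
    (hright : ∀ j, 0 < j → j < L → ∑ a, T.core j a * (T.core j a)ᵀ = 1) (τ : ℕ → ℝ)
    (hτ : ∀ (k m : ℕ) (h : k + m = L), 0 < k → 0 < m →
      ∑ j ∈ Finset.Ico (rk k) (Fintype.card (Fin m → σ)),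
        (Matrix.toEuclideanLin (T.evalUnfolding k m h)).singularValues j ^ 2 ≤ τ k) :
    ∑ s, (T.eval s - (ttRound (localSvdSel rk) T).eval s) ^ 2 ≤ ∑ k ∈ Finset.Ico 1 L, τ k := by
  refine sum_sq_sub_eval_ttRound_le rk T hL hrb hright τ fun k m h hk hm => ?_
  obtain ⟨R, hR, -, hRF⟩ :=
    Literature.LinearAlgebra.Matrix.exists_rank_le_sum_sq_norm_entry_sub_eq (T.evalUnfolding k m h)
      (rk k)
  refine ⟨R, hR, ?_⟩
  have hnorm : ∑ s, ∑ t, ‖(T.evalUnfolding k m h - R) s t‖ ^ 2 =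
      ∑ s, ∑ t, (T.evalUnfolding k m h - R) s t ^ 2 := by
    simp only [Real.norm_eq_abs, sq_abs]
  rw [← hnorm, hRF]
  exact hτ k m h hk hm

/-- TT-ROUNDING IS EXACT BELOW THE CAPS: for right-orthonormal input, if `rank T_⟨k⟩ ≤ rk k` for all
`0 < k < L` then `ttRound (localSvdSel rk) T` represents the same tensor as `T` (with bonds
`≤ min (rk k) (T.r k)`, `ttRound_r_le`); with `rk k = rank T_⟨k⟩` this is recompression to the
TT-ranks.  [cite: Oseledets2011, §2–§3] [cite: HoltzRohwedderSchneider2011, §3] -/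
theorem eval_ttRound_eq (rk : ℕ → ℕ) {L : ℕ} (T : TensorTrain ℝ σ L) (hL : T.r L = 1)
    (hrb : T.rbdry = fun _ => 1)
    (hright : ∀ j, 0 < j → j < L → ∑ a, T.core j a * (T.core j a)ᵀ = 1)
    (hrk : ∀ (k m : ℕ) (h : k + m = L), 0 < k → 0 < m → (T.evalUnfolding k m h).rank ≤ rk k)
    (s : Fin L → σ) : (ttRound (localSvdSel rk) T).eval s = T.eval s := by
  have h := sum_sq_sub_eval_ttRound_le rk T hL hrb hright (fun _ => 0) fun k m hkm hk hm =>
    ⟨T.evalUnfolding k m hkm, hrk k m hkm hk hm, by simp⟩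
  rw [Finset.sum_const_zero] at h
  have h0 : ∑ s, (T.eval s - (ttRound (localSvdSel rk) T).eval s) ^ 2 = 0 :=
    le_antisymm h (Finset.sum_nonneg fun s _ => sq_nonneg _)
  rw [Finset.sum_eq_zero_iff_of_nonneg fun s _ => sq_nonneg _] at h0
  exact (sub_eq_zero.mp ((pow_eq_zero_iff two_ne_zero).mp (h0 s (Finset.mem_univ s)))).symm

/-- In particular rounding with caps `rk k ≥ T.r k` changes nothing: a right-orthonormal train is
reproduced exactly (as a tensor) by `ttRound (localSvdSel rk)`.  [cite: Oseledets2011, §3]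
[cite: UschmajewVandereycken2020, §3.2] -/
theorem eval_ttRound_eq_of_r_le (rk : ℕ → ℕ) {L : ℕ} (T : TensorTrain ℝ σ L) (hL : T.r L = 1)
    (hrb : T.rbdry = fun _ => 1)
    (hright : ∀ j, 0 < j → j < L → ∑ a, T.core j a * (T.core j a)ᵀ = 1)
    (hrk : ∀ k, 0 < k → k < L → T.r k ≤ rk k) (s : Fin L → σ) :
    (ttRound (localSvdSel rk) T).eval s = T.eval s :=
  eval_ttRound_eq rk T hL hrb hright
    (fun k m h hk hm => (T.rank_evalUnfolding_le k m h).trans (hrk k hk (by omega))) s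

omit [Fintype σ] [DecidableEq σ] in
/-- [folklore] `Fin.append` as an equivalence `σ^k × σ^m ≃ σ^(k+m)`. -/
private def appendEquiv (k m : ℕ) : (Fin k → σ) × (Fin m → σ) ≃ (Fin (k + m) → σ) where
  toFun p := Fin.append p.1 p.2
  invFun u := (fun i => u (Fin.castAdd m i), fun j => u (Fin.natAdd k j))
  left_inv p := Prod.ext (funext fun i => Fin.append_left p.1 p.2 i)
    (funext fun j => Fin.append_right p.1 p.2 j)
  right_inv _ := Fin.append_castAdd_natAdd

omit [DecidableEq σ] in
/-- [folklore] summing over the two halves of a multi-index separately is summing over all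
multi-indices. -/
private theorem sum_sum_append {k m N : ℕ} (h : k + m = N) (f : (Fin N → σ) → ℝ) :
    ∑ s : Fin k → σ, ∑ t : Fin m → σ, f (fun i => Fin.append s t (i.cast h.symm)) = ∑ u, f u := by
  subst h
  simp only [Fin.cast_refl, id_eq]
  rw [← Fintype.sum_prod_type']
  exact (appendEquiv k m).sum_comp f

/-- QUASI-OPTIMALITY OF TT-ROUNDING (the `√(L-1)` factor of the TT-SVD, for Algorithm 2): for
right-orthonormal input, `‖T - ttRound (localSvdSel rk) T‖²_F ≤ (L - 1) · ‖T - T'‖²_F` for every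
tensor train `T'` with bond dimensions `T'.r k ≤ rk k` (`0 < k < L`).
[cite: Oseledets2011, §2–§3] [cite: UschmajewVandereycken2020, §3.2 (28)–(30)] -/
theorem sum_sq_sub_eval_ttRound_le_mul (rk : ℕ → ℕ) {L : ℕ} (T : TensorTrain ℝ σ L)
    (hL : T.r L = 1) (hrb : T.rbdry = fun _ => 1)
    (hright : ∀ j, 0 < j → j < L → ∑ a, T.core j a * (T.core j a)ᵀ = 1)
    (T' : TensorTrain ℝ σ L) (hT' : ∀ k, 0 < k → k < L → T'.r k ≤ rk k) :
    ∑ s, (T.eval s - (ttRound (localSvdSel rk) T).eval s) ^ 2 ≤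
      ((L - 1 : ℕ) : ℝ) * ∑ s, (T.eval s - T'.eval s) ^ 2 := by
  have h := sum_sq_sub_eval_ttRound_le rk T hL hrb hright (fun _ => ∑ s, (T.eval s - T'.eval s) ^ 2)
    fun k m hkm hk hm =>
      ⟨T'.evalUnfolding k m hkm,
        (T'.rank_evalUnfolding_le k m hkm).trans (hT' k hk (by omega)), by
          rw [← sum_sum_append hkm (fun u => (T.eval u - T'.eval u) ^ 2)]
          simp only [Matrix.sub_apply, TensorTrain.evalUnfolding, Matrix.of_apply, le_refl]⟩
  rw [Finset.sum_const, Nat.card_Ico, nsmul_eq_mul] at h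
  exact h

/-- BOTH PHASES OF ALGORITHM 2 FOR A MINIMAL REPRESENTATION.  If `T` is a minimal train
(`rank T_⟨k⟩ = r_k` at every interior bond, `r_0 = r_L = 1`, boundary vectors `1`), then the
orthogonalisation phase exists as a GAUGE transformation (`TensorTrain.exists_gauge_orthogonal`
of `TensorTrainOrthogonal` with centre `0`: same bond dimensions, same tensor by
`TensorTrain.eval_gauge`, right-orthonormal at the sites `0 < j < L`), and the truncation phase
`ttRound (localSvdSel rk)` applied to the gauged train approximates the tensor of `T` within
`∑_{0<k<L} b k` for any bounds `b k` on the rank-`rk k` approximation errors of the unfoldings.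
[cite: Oseledets2011, §3, Alg. 2] [cite: UschmajewVandereycken2020, §3.3 (33)]
[cite: OseledetsTyrtyshnikov2010, Thm 2.2] -/
theorem exists_gauge_sum_sq_sub_eval_ttRound_le (rk : ℕ → ℕ) {L : ℕ} (T : TensorTrain ℝ σ L)
    (h0 : T.r 0 = 1) (hL : T.r L = 1) (hl : T.lbdry = fun _ => 1) (hrb : T.rbdry = fun _ => 1)
    (hmin : ∀ (k m : ℕ) (h : k + m = L), 0 < k → 0 < m → (T.evalUnfolding k m h).rank = T.r k)
    (hL0 : 0 < L) (b : ℕ → ℝ)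
    (hb : ∀ (k m : ℕ) (h : k + m = L), 0 < k → 0 < m →
      ∃ R : Matrix (Fin k → σ) (Fin m → σ) ℝ, R.rank ≤ rk k ∧
        ∑ s, ∑ t, (T.evalUnfolding k m h - R) s t ^ 2 ≤ b k) :
    ∃ A B : (k : ℕ) → Matrix (Fin (T.r k)) (Fin (T.r k)) ℝ,
      (∀ k, A k * B k = 1) ∧ (∀ k, B k * A k = 1) ∧
      (∀ j, 0 < j → j < L → ∑ a, (T.gauge A B).core j a * ((T.gauge A B).core j a)ᵀ = 1) ∧
      ∑ s, (T.eval s - (ttRound (localSvdSel rk) (T.gauge A B)).eval s) ^ 2 ≤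
        ∑ k ∈ Finset.Ico 1 L, b k := by
  obtain ⟨A, B, hAB, hBA, -, hrb', -, -, -, hright⟩ :=
    T.exists_gauge_orthogonal h0 hL hl hrb hmin 0 hL0
  refine ⟨A, B, hAB, hBA, hright, ?_⟩
  have hU : ∀ (k m : ℕ) (h : k + m = L),
      (T.gauge A B).evalUnfolding k m h = T.evalUnfolding k m h := fun k m h => by
    ext s t
    simp only [TensorTrain.evalUnfolding, Matrix.of_apply, T.eval_gauge A B hAB]
  have key := sum_sq_sub_eval_ttRound_le rk (T.gauge A B) hL hrb' hright b fun k m h hk hm => by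
    rw [hU k m h]
    exact hb k m h hk hm
  simpa only [T.eval_gauge A B hAB] using key

end Rounding

end Literature.LinearAlgebra.TensorNetworks

-- AI-produced formalisation (H21 engines group, seat eng-quad-2, 2026-08-22); no facts, no axioms
-- beyond Mathlib's, no `sorry`.
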